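import Mathlib
import Summits.ValiantsHypothesis.ValiantsHypothesis.Theorems.GrenetZeonTwoDimCoefficientsDefs
import Summits.ValiantsHypothesis.ValiantsHypothesis.Theorems.GrenetZeonTwoDimCoefficientsScalingShadowFamily

/-!
# Crux `GrenetZeon.TwoDimCoefficients` (stmt-ValiantsHypothesis-8062), stub `stub_dualUnipotent`:
# scaling-closure — only the LOW companions matter (`deg D_k ≤ m`)

The companions of a unipotent dual representation are the top forms `[D_k]_{kn}` of
`D_k = [X^k] det(X·B + A)`.  Since `A, B` are affine, `deg D_k ≤ m` (`totalDegree_coeff_det_le`), so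
`[D_k]_d = 0` automatically for `d > m`; in particular every companion with `k·n > m` vanishes and the
companion-free rung ✓ `sq_le_two_mul_of_companionFree` needs its hypothesis only for the finitely many LOW
orders `2 ≤ k ≤ m/n`:

* `totalDegree_coeff_prod_le`, `totalDegree_coeff_affine_entry_le`, ★ `totalDegree_coeff_det_le`;
* ★ `sq_le_two_mul_of_lowCompanionFree` — `det A = c ≠ 0`, `per_n = α·c + β·tr(adj A·B)`, `n ≥ 3`, `m ≥ 2`,
  and `[D_k]_d = 0` for `k·n ≤ d` only for `2 ≤ k` with `k·n ≤ m` ⟹ `n² ≤ 2m` (for `m < 2n` the hypothesis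
  is vacuous: this re-derives the rung ✓ `two_mul_le_of_dualUnipotentRepr`).

HONEST FRAMING: bookkeeping that sharpens the hypothesis of a conditional-on-shape rung; the stub, the crux and
`VP ≠ VNP` remain open.

References: T. Mignon, N. Ressayre, Int. Math. Res. Not. 2004:79, Thm. 1.1 (via the tree).
-/

-- single-conjunct layout `Summits/ValiantsHypothesis/ValiantsHypothesis`: the duplicated namespace
-- component is mandated by the tree.
set_option linter.dupNamespace false
set_option autoImplicit false

noncomputable section

namespace Summit.ValiantsHypothesis.ValiantsHypothesis.Theorems.GrenetZeonTwoDimCoefficients.ScalingClosure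

open MvPolynomial Matrix
open Literature.Computability.AlgebraicComplexity
open Summit.ValiantsHypothesis.ValiantsHypothesis.Cruxes.TwoDimCoefficients.DimTwoCases

/-! ### Degrees of the coefficients of `det (X·B + A)` -/

section Degree

variable {σ : Type*} {ι : Type*} [DecidableEq ι]

/-- Coefficients of a product of polynomials in `X` whose coefficients are affine have total degree at
most the number of factors. [folklore] -/
theorem totalDegree_coeff_prod_le (s : Finset ι) (p : ι → Polynomial (MvPolynomial σ ℂ))
    (hp : ∀ i ∈ s, ∀ j, ((p i).coeff j).totalDegree ≤ 1) (j : ℕ) :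
    ((∏ i ∈ s, p i).coeff j).totalDegree ≤ s.card := by
  induction s using Finset.induction_on generalizing j with
  | empty =>
    simp only [Finset.prod_empty, Polynomial.coeff_one, Finset.card_empty]
    split_ifs
    · exact (totalDegree_one).le
    · exact (totalDegree_zero).le
  | insert a s ha ih =>
    rw [Finset.prod_insert ha, Polynomial.coeff_mul, Finset.card_insert_of_notMem ha]
    refine (totalDegree_finsetSum _ _).trans (Finset.sup_le fun x _ => ?_)
    refine (totalDegree_mul _ _).trans ?_
    have h1 := hp a (Finset.mem_insert_self a s) x.1
    have h2 := ih (fun i hi j => hp i (Finset.mem_insert_of_mem hi) j) x.2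
    omega

/-- The entries `X·b + a` of `X·B + A` (`a, b` affine) have affine coefficients. [folklore] -/
theorem totalDegree_coeff_affine_entry_le {a b : MvPolynomial σ ℂ} (ha : a.totalDegree ≤ 1)
    (hb : b.totalDegree ≤ 1) (j : ℕ) :
    (((Polynomial.X : Polynomial (MvPolynomial σ ℂ)) • Polynomial.C b + Polynomial.C a).coeff j).totalDegree
      ≤ 1 := by
  rw [smul_eq_mul, mul_comm, Polynomial.coeff_add, ← pow_one (Polynomial.X : Polynomial (MvPolynomial σ ℂ)),
    Polynomial.coeff_C_mul_X_pow, Polynomial.coeff_C]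
  refine (totalDegree_add _ _).trans (max_le ?_ ?_)
  · split_ifs
    · exact hb
    · exact (totalDegree_zero).le.trans zero_le_one
  · split_ifs
    · exact ha
    · exact (totalDegree_zero).le.trans zero_le_one

variable [Fintype ι]

/-- ★ **`deg [X^k] det(X·B + A) ≤ m`** for affine `m × m` matrices `A, B`. [folklore] -/
theorem totalDegree_coeff_det_le (A B : Matrix ι ι (MvPolynomial σ ℂ))
    (hA : ∀ i j, (A i j).totalDegree ≤ 1) (hB : ∀ i j, (B i j).totalDegree ≤ 1) (k : ℕ) :
    ((det ((Polynomial.X : Polynomial (MvPolynomial σ ℂ)) • B.map Polynomial.C +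
      A.map Polynomial.C)).coeff k).totalDegree ≤ Fintype.card ι := by
  rw [det_apply', Polynomial.finsetSum_coeff]
  refine (totalDegree_finsetSum _ _).trans (Finset.sup_le fun τ _ => ?_)
  rw [← map_intCast (Polynomial.C : MvPolynomial σ ℂ →+* Polynomial (MvPolynomial σ ℂ)),
    Polynomial.coeff_C_mul]
  refine (totalDegree_mul _ _).trans ?_
  rw [← map_intCast (MvPolynomial.C : ℂ →+* MvPolynomial σ ℂ), totalDegree_C, zero_add]
  have h := totalDegree_coeff_prod_le (σ := σ) Finset.univ
    (fun i => ((Polynomial.X : Polynomial (MvPolynomial σ ℂ)) • B.map Polynomial.C +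
      A.map Polynomial.C) (τ i) i) (fun i _ j => by
      rw [Matrix.add_apply, Matrix.smul_apply, Matrix.map_apply, Matrix.map_apply]
      exact totalDegree_coeff_affine_entry_le (hA _ _) (hB _ _) j) k
  rwa [Finset.card_univ] at h

end Degree

/-! ### Only the low companions matter -/

section Low

/-- ★ **`n² ≤ 2m` when the LOW companions vanish.**  `det A = c ≠ 0`, `per_n = α·c + β·tr(adj A·B)`
(`n ≥ 3`, `m ≥ 2`), and `[D_k]_d = 0` for `d ≥ k·n` for the orders `2 ≤ k` with `k·n ≤ m` only
(`D_k = [X^k] det(X·B + A)`; for `k·n > m` this is automatic by ✓ `totalDegree_coeff_det_le`) ⟹ `n² ≤ 2m`.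
[cite: MignonRessayre2004, Thm. 1.1 — via the tree; folklore] -/
theorem sq_le_two_mul_of_lowCompanionFree {k m : ℕ} (A B : AffMat (k + 3) m) (hA : IsAffine A)
    (hB : IsAffine B) (α β c : ℂ) (hc : c ≠ 0) (hβ : β ≠ 0) (hdet : A.det = MvPolynomial.C c)
    (hper : perPoly (Fin (k + 3)) ℂ =
      MvPolynomial.C α * A.det + MvPolynomial.C β * (A.adjugate * B).trace)
    (hm2 : 2 ≤ m)
    (hfree : ∀ j, 2 ≤ j → j * (k + 3) ≤ m → ∀ d, j * (k + 3) ≤ d →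
      homogeneousComponent d ((det ((Polynomial.X : Polynomial (MvPolynomial (Fin (k + 3) ×
        Fin (k + 3)) ℂ)) • B.map Polynomial.C + A.map Polynomial.C)).coeff j) = 0) :
    (k + 3) ^ 2 ≤ 2 * m := by
  classical
  refine sq_le_two_mul_of_companionFree A B hA hB α β c hc hβ hdet hper hm2 (fun j =>
    (det ((Polynomial.X : Polynomial (MvPolynomial (Fin (k + 3) × Fin (k + 3)) ℂ)) •
      B.map Polynomial.C + A.map Polynomial.C)).coeff j) (fun j => rfl) ?_
  intro j hj d hd
  by_cases hjm : j * (k + 3) ≤ m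
  · exact hfree j hj hjm d hd
  · refine homogeneousComponent_eq_zero _ _ ?_
    have h := totalDegree_coeff_det_le A B hA hB j
    rw [Fintype.card_fin] at h
    omega

end Low

end Summit.ValiantsHypothesis.ValiantsHypothesis.Theorems.GrenetZeonTwoDimCoefficients.ScalingClosure

end
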